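import Literature.NumberTheory.DiophantineGeometry.FaltingsHeightJInvariantProofs
import Literature.NumberTheory.EllipticCurves.SilvermanHeightLogDiscriminantProofs
import Literature.NumberTheory.LFunctions.RobinOscillation
import Literature.Probability.LatticeModels.HalfPlanePoissonKernel
import Mathlib.Analysis.Complex.ExponentialBounds
import Mathlib.Analysis.Real.Pi.Bounds
import HarnessLib

/-!
# Silverman's lower bound `h_F(E) ≤ h(j_E)/12 − C₁/12` with an explicit constant

Topic `NumberTheory/DiophantineGeometry`; an explicit form of the lower inequality of
[cite: Silverman1986, Prop. 2.1], whose tree version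
`exists_bounds_log_max_j_add_faltingsArchTerm` (`FaltingsHeightJInvariantProofs`) hides the
constants behind an `∃`. We prove, for every elliptic curve `V/ℂ`,

  **`9 ≤ log max(|j(V)|, 1) + (log|Δ_V| + 6 log((i/2)∫ ω ∧ ω̄))`**
  (`nine_le_log_max_j_add_faltingsArchTerm`),

by the argument of Silverman's §2 with numerical constants: reduce the period lattice to
`ω(ℤτ + ℤ)`, `Im τ ≥ 1/2`, where the sum is `log(2¹²π¹²) + log max(|Δ(τ)|, |E₄(τ)|³) + 6 log Im τ`;
for `Im τ ≥ 1` the `q`-expansion gives `|E₄(τ)| ≥ 1/4` (`|q| ≤ e^{−2π} ≤ 1/400`,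
`σ₃(n) ≤ n⁴ ≤ 2·4ⁿ`), and for `1/2 ≤ Im τ ≤ 1` the `η`-product gives
`|Δ(τ)| ≥ e^{−2π}(1 − r/(1−r))²⁴ ≥ 1/2400` (`r = |q| ≤ e^{−π} ≤ 1/20`); so the sum is
`≥ log(4096π¹²) − 6 log 2 − log 2400 ≥ 9`. Consequently (**`stableFaltingsHeight_le_explicit`**)
`h_F(E) ≤ (1/12)([K:ℚ]⁻¹ log N(𝔇_j) + [K:ℚ]⁻¹ Σ_σ log max(|σ j|, 1) − 9)` for every `E` over a
number field `K` (the bracket is the Weil height of `j` up to the constant), and in particular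
**`stableFaltingsHeight_le_one_of_j_eq`**: `h_F(E) ≤ 1` for `j(E) = 207646/6561`, the last class of
curves of Belyi degree `4` (`BelyiDegreeFourConverse`); more generally (appended)
**`stableFaltingsHeight_le_of_j_eq_ratCast`**: `h_F(E) ≤ (1/12)(log max(|a|, b) − 9)` for
rational `j(E) = a/b`, and `stableFaltingsHeight_le_logHeight₁` (the same via Mathlib's
`logHeight₁`).

The reduction lemmas of `FaltingsHeightJInvariantProofs` are private there and are repeated here
(private). The appended upper-bound section (`norm_E₄_le`, `norm_discriminant_le`,
`log_max_j_add_faltingsArchTerm_le`, `bounds_log_max_j_add_faltingsArchTerm`) gives the other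
inequality with the constant `37`, whence **`silverman1986_jHeight_faltingsHeight_explicit`**
(Silverman's Prop. 2.1 with `(C₁, C₂) = (9, 37)`) and
**`jHeight_le_stableFaltingsHeight_explicit`** (`h(j) ≤ 12 h_F + 6 log(1 + h(j)) + 37`).
Everything is proved; no definitions.

## References

* J. H. Silverman, *Heights and elliptic curves*, in Arithmetic Geometry (Cornell–Silverman
  eds.), Springer (1986): Prop. 1.1, §2 eqs. (4)–(7), Prop. 2.1. [Silverman1986]
* J. H. Silverman, *The Arithmetic of Elliptic Curves*, 2nd ed. (2009), VI.5.1, C.12.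
  [SilvermanAEC2009]
-/

noncomputable section

namespace Literature.NumberTheory.DiophantineGeometry

namespace FaltingsHeightExplicit

open _root_.NumberField _root_.WeierstrassCurve _root_.Height
open _root_.Complex _root_.UpperHalfPlane _root_.EisensteinSeries _root_.ModularForm
open scoped MatrixGroups Real ArithmeticFunction.sigma
open Literature.NumberTheory.EllipticCurves

/-! ### Numerical constants -/

/-- `e⁶ ≥ 403`. [folklore] -/
theorem exp_six_ge : (403 : ℝ) ≤ Real.exp 6 := by
  have h1 : (2.7182818283 : ℝ) < Real.exp 1 := Real.exp_one_gt_d9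
  have : Real.exp 6 = Real.exp 1 ^ 6 := by rw [← Real.exp_nat_mul]; norm_num
  rw [this]
  have h0 : (0 : ℝ) ≤ 2.7182818283 := by norm_num
  have := pow_le_pow_left₀ h0 h1.le 6
  exact le_trans (by norm_num) this

/-- `e^{−2π} ≤ 1/400`. [folklore] -/
theorem exp_neg_two_pi_le : Real.exp (-(2 * π)) ≤ 1 / 400 := by
  have h6 : (6 : ℝ) ≤ 2 * π := by have := Real.pi_gt_three; linarith
  rw [Real.exp_neg, ← one_div]
  refine one_div_le_one_div_of_le (by norm_num) ?_
  exact le_trans (by linarith [exp_six_ge]) (Real.exp_le_exp.mpr h6)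

/-- `e^{2π} ≤ 600`, i.e. `1/600 ≤ e^{−2π}`. [folklore] -/
theorem inv_six_hundred_le_exp_neg_two_pi : 1 / 600 ≤ Real.exp (-(2 * π)) := by
  have hπ : π < 3.1416 := Real.pi_lt_d4
  have h1 : Real.exp 1 < 2.7182818286 := Real.exp_one_lt_d9
  -- `e^{2π} ≤ e^{6.3} = e⁶ · e^{0.3} ≤ 404 · (1/(1 - 0.3))`
  have he6 : Real.exp 6 ≤ 404 := by
    have : Real.exp 6 = Real.exp 1 ^ 6 := by rw [← Real.exp_nat_mul]; norm_num
    rw [this]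
    have := pow_le_pow_left₀ (Real.exp_pos 1).le h1.le 6
    exact this.trans (by norm_num)
  have he03 : Real.exp (0.3 : ℝ) ≤ 1 / (1 - 0.3) := by
    have h := Real.add_one_le_exp (-(0.3 : ℝ))
    rw [Real.exp_neg] at h
    rw [le_div_iff₀ (by norm_num)]
    have hpos := Real.exp_pos (0.3 : ℝ)
    have : (1 - 0.3 : ℝ) ≤ (Real.exp 0.3)⁻¹ := by linarith
    calc Real.exp 0.3 * (1 - 0.3) ≤ Real.exp 0.3 * (Real.exp 0.3)⁻¹ := by gcongr
      _ = 1 := mul_inv_cancel₀ hpos.ne'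
  have h63 : Real.exp (2 * π) ≤ 600 := by
    calc Real.exp (2 * π) ≤ Real.exp (6 + 0.3) := Real.exp_le_exp.mpr (by linarith)
      _ = Real.exp 6 * Real.exp 0.3 := Real.exp_add _ _
      _ ≤ 404 * (1 / (1 - 0.3)) := by gcongr
      _ ≤ 600 := by norm_num
  rw [Real.exp_neg, one_div, inv_le_inv₀ (by norm_num) (Real.exp_pos _)]
  exact h63

/-- `n⁴ ≤ 2·4ⁿ`. [folklore] -/
theorem pow_four_le_two_mul_four_pow (n : ℕ) : (n : ℝ) ^ 4 ≤ 2 * 4 ^ n := by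
  rcases lt_or_ge n 4 with h | h
  · interval_cases n <;> norm_num
  · induction n, h using Nat.le_induction with
    | base => norm_num
    | succ k hk ih =>
      have hk' : (4 : ℝ) ≤ k := by exact_mod_cast hk
      have step : ((k : ℝ) + 1) ^ 4 ≤ 4 * (k : ℝ) ^ 4 := by
        have h1 : (k : ℝ) + 1 ≤ 5 / 4 * k := by linarith
        have h0 : (0 : ℝ) ≤ k + 1 := by positivity
        calc ((k : ℝ) + 1) ^ 4 ≤ (5 / 4 * k) ^ 4 := pow_le_pow_left₀ h0 h1 4
          _ ≤ 4 * (k : ℝ) ^ 4 := by nlinarith [pow_nonneg (by positivity : (0:ℝ) ≤ k) 4]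
      push_cast
      calc ((k : ℝ) + 1) ^ 4 ≤ 4 * (k : ℝ) ^ 4 := step
        _ ≤ 4 * (2 * 4 ^ k) := by linarith
        _ = 2 * 4 ^ (k + 1) := by ring

/-- `σ₃(n) ≤ 2·4ⁿ`. [folklore] -/
theorem sigma_three_le (n : ℕ) : (σ 3 n : ℝ) ≤ 2 * 4 ^ n := by
  have h1 : (σ 3 n : ℝ) ≤ (n : ℝ) ^ 4 := by
    exact_mod_cast ArithmeticFunction.sigma_le_pow_succ 3 n
  exact h1.trans (pow_four_le_two_mul_four_pow n)

/-! ### `|E₄(τ)| ≥ 1/4` for `Im τ ≥ 1` -/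

/-- **`|E₄(τ) − 1| ≤ 3/4` for `Im τ ≥ 1`**: `E₄ = 1 + 240 ∑_{n≥1} σ₃(n) qⁿ` with `|q| ≤ e^{−2π} ≤
1/400`, `|∑| ≤ r + ∑_{n≥2} 2(4r)ⁿ = r + 32r²/(1 − 4r)`. (Silverman's (5): `E₄ → 1` at the cusp.)
[cite: Silverman1986, §2 eq. (5)] -/
theorem norm_E₄_sub_one_le (τ : ℍ) (hτ : 1 ≤ τ.im) : ‖(E₄ τ : ℂ) - 1‖ ≤ 3 / 4 := by
  have h := EisensteinSeries.q_expansion_bernoulli (by norm_num : 3 ≤ 4) (by decide) τ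
  have hb : bernoulli 4 = -1 / 30 := by
    rw [bernoulli_eq_bernoulli'_of_ne_one (by norm_num), bernoulli'_four]
  simp_rw [zpow_natCast] at h
  rw [hb] at h
  set q : ℂ := cexp (2 * π * Complex.I * τ) with hqdef
  set r : ℝ := ‖q‖ with hrdef
  have hr : r = Real.exp (-(2 * π * τ.im)) := by
    rw [hrdef, hqdef, Complex.norm_exp]
    congr 1
    simp [Complex.mul_re, UpperHalfPlane.coe_im, UpperHalfPlane.coe_re]
  have h' : (E₄ τ : ℂ) = 1 + 240 * ∑' n : ℕ+, (σ 3 n : ℂ) * q ^ (n : ℕ) := by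
    rw [show (E₄ τ : ℂ) = E (by norm_num : 3 ≤ 4) τ from rfl, h]
    simp only [show (4 - 1 : ℕ) = 3 from rfl]
    push_cast
    ring
  have hr0 : 0 ≤ r := norm_nonneg _
  have hr400 : r ≤ 1 / 400 := by
    rw [hr]
    refine le_trans (Real.exp_le_exp.mpr ?_) exp_neg_two_pi_le
    nlinarith [Real.pi_pos]
  have h4r : 4 * r < 1 := by linarith
  have h4r0 : 0 ≤ 4 * r := by linarith
  -- the series over `ℕ`
  set g : ℕ → ℂ := fun m ↦ (σ 3 (m + 1) : ℂ) * q ^ (m + 1) with hgdef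
  have hS : ∑' n : ℕ+, (σ 3 n : ℂ) * q ^ (n : ℕ) = ∑' m : ℕ, g m :=
    tsum_pnat_eq_tsum_succ (f := fun n : ℕ ↦ (σ 3 n : ℂ) * q ^ n)
  have hbound : ∀ m, ‖g m‖ ≤ 2 * (4 * r) ^ (m + 1) := fun m ↦ by
    rw [hgdef]
    simp only [norm_mul, norm_pow, Complex.norm_natCast, ← hrdef]
    calc (σ 3 (m + 1) : ℝ) * r ^ (m + 1) ≤ 2 * 4 ^ (m + 1) * r ^ (m + 1) := by
          gcongr; exact sigma_three_le _
      _ = 2 * (4 * r) ^ (m + 1) := by rw [mul_pow]; ring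
  have hgeom : Summable (fun m : ℕ ↦ 2 * (4 * r) ^ (m + 1)) := by
    have := (summable_geometric_of_lt_one h4r0 h4r).mul_left (2 * (4 * r))
    refine this.congr (fun m ↦ ?_); ring
  have hsum : Summable g := Summable.of_norm_bounded hgeom hbound
  have hsplit := hsum.tsum_eq_zero_add
  have hg0 : g 0 = q := by
    simp [hgdef, ArithmeticFunction.sigma_apply, Nat.divisors_one]
  have htail_sum : Summable (fun m ↦ g (m + 1)) := (summable_nat_add_iff 1).mpr hsum
  have hgeom2 : Summable (fun m : ℕ ↦ 2 * (4 * r) ^ (m + 2)) := by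
    have := (summable_geometric_of_lt_one h4r0 h4r).mul_left (2 * (4 * r) ^ 2)
    refine this.congr (fun m ↦ ?_); ring
  have htail_le : ‖∑' m, g (m + 1)‖ ≤ 2 * (4 * r) ^ 2 / (1 - 4 * r) := by
    have h1 : ‖∑' m, g (m + 1)‖ ≤ ∑' m : ℕ, 2 * (4 * r) ^ (m + 2) :=
      tsum_of_norm_bounded hgeom2.hasSum fun m ↦ by
        have := hbound (m + 1); rwa [show m + 1 + 1 = m + 2 by ring] at this
    have hval : ∑' m : ℕ, 2 * (4 * r) ^ (m + 2) = 2 * (4 * r) ^ 2 / (1 - 4 * r) := by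
      rw [show (fun m : ℕ ↦ 2 * (4 * r) ^ (m + 2)) = fun m ↦ (2 * (4 * r) ^ 2) * (4 * r) ^ m by
        funext m; ring]
      rw [tsum_mul_left, tsum_geometric_of_lt_one h4r0 h4r]
      field_simp
    rw [hval] at h1; exact h1
  -- `E₄ τ - 1 = 240 * (q + tail)`
  have hE : (E₄ τ : ℂ) - 1 = 240 * (q + ∑' m, g (m + 1)) := by
    rw [h', hS, hsplit, hg0]
    ring
  rw [hE, norm_mul, Complex.norm_ofNat]
  have hq : ‖q + ∑' m, g (m + 1)‖ ≤ r + 2 * (4 * r) ^ 2 / (1 - 4 * r) :=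
    (norm_add_le _ _).trans (add_le_add le_rfl htail_le)
  have hnum : r + 2 * (4 * r) ^ 2 / (1 - 4 * r) ≤ 1 / 320 := by
    have h99 : (99 / 100 : ℝ) ≤ 1 - 4 * r := by linarith
    have hsq : 2 * (4 * r) ^ 2 / (1 - 4 * r) ≤ 2 * (4 * r) ^ 2 / (99 / 100) :=
      div_le_div_of_nonneg_left (by positivity) (by norm_num) h99
    have hr2 : (4 * r) ^ 2 ≤ (1 / 100) ^ 2 := pow_le_pow_left₀ h4r0 (by linarith) 2
    have hsq' : 2 * (4 * r) ^ 2 / (99 / 100) ≤ 2 * (1 / 100) ^ 2 / (99 / 100) := by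
      gcongr
    have : (2 * (1 / 100) ^ 2 / (99 / 100) : ℝ) ≤ 1 / 4000 := by norm_num
    linarith
  nlinarith [norm_nonneg (q + ∑' m, g (m + 1))]

/-- **`|E₄(τ)| ≥ 1/4` for `Im τ ≥ 1`.** [cite: Silverman1986, §2 eq. (5)] -/
theorem one_quarter_le_norm_E₄ (τ : ℍ) (hτ : 1 ≤ τ.im) : 1 / 4 ≤ ‖(E₄ τ : ℂ)‖ := by
  have h := norm_E₄_sub_one_le τ hτ
  have h1 : ‖(1 : ℂ)‖ - ‖(1 : ℂ) - E₄ τ‖ ≤ ‖(E₄ τ : ℂ)‖ := by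
    have := norm_sub_norm_le (1 : ℂ) ((1 : ℂ) - E₄ τ)
    rwa [sub_sub_cancel] at this
  rw [norm_one, norm_sub_rev] at h1
  linarith

/-! ### `|Δ(τ)| ≥ 1/2400` for `1/2 ≤ Im τ ≤ 1` -/

/-- Finite pieces: `1 − r/(1 − r) ≤ ∏_{i ∈ s} ‖1 − q^{i+1}‖` for `‖q‖ = r ≤ 1/2`. [folklore] -/
theorem one_sub_le_prod_norm_one_sub_pow {q : ℂ} (hq : ‖q‖ ≤ 1 / 2) (s : Finset ℕ) :
    1 - ‖q‖ / (1 - ‖q‖) ≤ ∏ i ∈ s, ‖1 - q ^ (i + 1)‖ := by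
  set r : ℝ := ‖q‖ with hr
  have hr0 : 0 ≤ r := norm_nonneg q
  have hr1 : r < 1 := by linarith
  have hgeom : HasSum (fun i : ℕ ↦ r ^ (i + 1)) (r / (1 - r)) := by
    have h := (hasSum_geometric_of_lt_one hr0 hr1).mul_left r
    simp_rw [← pow_succ'] at h
    rwa [div_eq_mul_inv]
  calc 1 - r / (1 - r) ≤ 1 - ∑ i ∈ s, r ^ (i + 1) := by
        have := sum_le_hasSum s (fun i _ ↦ pow_nonneg hr0 (i + 1)) hgeom
        linarith
    _ ≤ ∏ i ∈ s, (1 - r ^ (i + 1)) :=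
        LFunctions.RobinOscillation.one_sub_sum_le_prod s _ (fun i _ ↦ pow_nonneg hr0 _)
          fun i _ ↦ pow_le_one₀ hr0 hr1.le
    _ ≤ ∏ i ∈ s, ‖1 - q ^ (i + 1)‖ := by
        refine Finset.prod_le_prod (fun i _ ↦ sub_nonneg.2 (pow_le_one₀ hr0 hr1.le)) fun i _ ↦ ?_
        calc 1 - r ^ (i + 1) = ‖(1 : ℂ)‖ - ‖q ^ (i + 1)‖ := by rw [norm_one, norm_pow]
          _ ≤ ‖1 - q ^ (i + 1)‖ := norm_sub_norm_le _ _

/-- `1 − r/(1 − r) ≤ ‖∏' (1 − q^{n+1})‖` for `‖q‖ = r ≤ 1/2`. [folklore] -/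
theorem one_sub_le_norm_tprod_one_sub_pow {q : ℂ} (hq : ‖q‖ ≤ 1 / 2) :
    1 - ‖q‖ / (1 - ‖q‖) ≤ ‖∏' n : ℕ, (1 - q ^ (n + 1))‖ := by
  have hq1 : ‖q‖ < 1 := by linarith
  rw [(ModularForm.multipliable_one_sub_pow hq1).norm_tprod]
  have hmult : Multipliable fun n : ℕ ↦ ‖1 - q ^ (n + 1)‖ := by
    have h := ModularForm.multipliable_one_sub_pow hq1
    exact h.norm
  exact le_hasProd_of_le_prod hmult.hasProd (one_sub_le_prod_norm_one_sub_pow hq)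

/-- **`|Δ(τ)| ≥ 1/2400` for `1/2 ≤ Im τ ≤ 1`**: `Δ = η²⁴ = q ∏(1 − qⁿ)²⁴` with
`|q| = e^{−2π Im τ} ≥ e^{−2π} ≥ 1/600` and `∏|1 − qⁿ| ≥ 1 − r/(1−r) ≥ 18/19` for
`r = e^{−2π Im τ} ≤ e^{−π} ≤ 1/20`, `(18/19)²⁴ ≥ 1/4`. (Silverman's (4):
`log|Δ(τ)| = log|q| + O(1)`.)
[cite: Silverman1986, §2 eq. (4)] -/
theorem le_norm_discriminant (τ : ℍ) (h₁ : 1 / 2 ≤ τ.im) (h₂ : τ.im ≤ 1) :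
    1 / 2400 ≤ ‖ModularForm.discriminant τ‖ := by
  set q : ℂ := cexp (2 * π * Complex.I * τ) with hqdef
  set r : ℝ := ‖q‖ with hrdef
  have hr : r = Real.exp (-(2 * π * τ.im)) := by
    rw [hrdef, hqdef, Complex.norm_exp]
    congr 1
    simp [Complex.mul_re, UpperHalfPlane.coe_im, UpperHalfPlane.coe_re]
  have h24 : ‖Function.Periodic.qParam 24 (τ : ℂ)‖ ^ 24 = r := by
    rw [hr, Function.Periodic.norm_qParam, ← Real.exp_nat_mul]
    congr 1
    rw [UpperHalfPlane.coe_im]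
    push_cast
    ring
  have hrle : r ≤ 1 / 20 := by
    rw [hr]
    refine le_trans (Real.exp_le_exp.mpr ?_) Probability.LatticeModels.exp_neg_pi_le
    nlinarith [Real.pi_pos]
  have hrge : 1 / 600 ≤ r := by
    rw [hr]
    refine le_trans inv_six_hundred_le_exp_neg_two_pi (Real.exp_le_exp.mpr ?_)
    nlinarith [Real.pi_pos]
  have hr0 : 0 ≤ r := norm_nonneg _
  have hq : ‖q‖ ≤ 1 / 2 := by rw [← hrdef]; linarith
  have hprod := one_sub_le_norm_tprod_one_sub_pow hq
  rw [← hrdef] at hprod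
  have h1r : 0 < 1 - r := by linarith
  have hdiv : r / (1 - r) ≤ 1 / 19 := by
    rw [div_le_div_iff₀ h1r (by norm_num)]; nlinarith
  have hprod' : (18 / 19 : ℝ) ≤ ‖∏' n : ℕ, (1 - q ^ (n + 1))‖ := by linarith
  -- `Δ = (𝕢₂₄ ∏ (1 − qⁿ))²⁴`
  have heta : ∏' n : ℕ, (1 - ModularForm.eta_q n (τ : ℂ)) = ∏' n : ℕ, (1 - q ^ (n + 1)) :=
    tprod_congr fun n ↦ by rw [ModularForm.eta_q_eq_pow]
  have hΔ : ‖ModularForm.discriminant τ‖ = r * ‖∏' n : ℕ, (1 - q ^ (n + 1))‖ ^ 24 := by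
    rw [ModularForm.discriminant, norm_pow, ModularForm.eta, norm_mul, mul_pow, h24, heta]
  rw [hΔ]
  have hpow : (1 / 4 : ℝ) ≤ ‖∏' n : ℕ, (1 - q ^ (n + 1))‖ ^ 24 :=
    le_trans (by norm_num) (pow_le_pow_left₀ (by norm_num) hprod' 24)
  calc (1 / 2400 : ℝ) = 1 / 600 * (1 / 4) := by norm_num
    _ ≤ r * ‖∏' n : ℕ, (1 - q ^ (n + 1))‖ ^ 24 := by gcongr

/-! ### Reduction of a period lattice to `ω(ℤτ + ℤ)`, `Im τ ≥ 1/2` (repeated from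
`FaltingsHeightJInvariantProofs`, where these lemmas are private) -/


/-- `covol(ℤω₁ + ℤω₂) = |Re ω₁ Im ω₂ − Im ω₁ Re ω₂|` for Lebesgue measure on `ℂ` (the area of a
fundamental parallelogram; Silverman 1986, proof of Prop. 1.1). [folklore] -/
private theorem covolume_lattice_eq (L : PeriodPair) :
    ZLattice.covolume L.lattice = |L.ω₁.re * L.ω₂.im - L.ω₁.im * L.ω₂.re| := by
  classical
  rw [ZLattice.covolume_eq_det_mul_measureReal L.lattice MeasureTheory.volume L.latticeBasis
    Complex.basisOneI]
  have h1 : MeasureTheory.volume.real (ZSpan.fundamentalDomain Complex.basisOneI) = 1 := by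
    rw [MeasureTheory.measureReal_congr
      (ZSpan.fundamentalDomain_ae_parallelepiped Complex.basisOneI MeasureTheory.volume),
      MeasureTheory.measureReal_def, ← Complex.toBasis_orthonormalBasisOneI,
      OrthonormalBasis.coe_toBasis, Complex.orthonormalBasisOneI.volume_parallelepiped]
    simp
  rw [h1, mul_one, Module.Basis.det_apply, Matrix.det_fin_two]
  simp only [Module.Basis.toMatrix_apply, Complex.coe_basisOneI_repr, Function.comp_apply,
    PeriodPair.latticeBasis_zero, PeriodPair.latticeBasis_one, Matrix.cons_val_zero,
    Matrix.cons_val_one]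
  congr 1; ring

/-- The lattice sums `G_k(Λ) = ∑_{λ ∈ Λ} λ^{-k}` written over `ℤ²`. [folklore] -/
private theorem G_eq_tsum_prod (L : PeriodPair) (k : ℕ) :
    L.G k = ∑' x : ℤ × ℤ, ((x.1 * L.ω₁ + x.2 * L.ω₂) ^ k)⁻¹ := by
  rw [PeriodPair.G, ← (Equiv.tsum_eq L.latticeEquivProd.symm.toEquiv
    (fun l : L.lattice => ((l : ℂ) ^ k)⁻¹))]
  congr with x
  simp [L.latticeEquiv_symm_apply]

/-- Reindexing `ℤ × ℤ ≃ (Fin 2 → ℤ)` in the Eisenstein summands. [folklore] -/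
private theorem tsum_prod_eisSummand (k : ℤ) (τ : ℍ) :
    ∑' x : ℤ × ℤ, eisSummand k ![x.2, x.1] τ = ∑' v : Fin 2 → ℤ, eisSummand k v τ := by
  rw [← Equiv.tsum_eq ((Equiv.prodComm ℤ ℤ).trans (finTwoArrowEquiv ℤ).symm)]
  rfl

/-- `∑_{(m,n) ∈ ℤ²} (mτ + n)^{-k} = 2ζ(k) E_k(τ)`. [folklore] -/
private theorem two_mul_zeta_mul_E_apply {k : ℕ} (hk : 3 ≤ k) (τ : ℍ) :
    2 * riemannZeta k * E hk τ = ∑' v : Fin 2 → ℤ, eisSummand k v τ := by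
  rw [tsum_eisSummand_eq_riemannZeta_mul_eisensteinSeries hk,
    show E hk τ = (1 / 2 : ℂ) • eisensteinSeriesSIF (N := 1) 0 k τ from rfl,
    eisensteinSeriesSIF_apply, smul_eq_mul]
  ring

/-- `G_k(ℤω₁ + ℤω₂) = ω₁^{-k} · 2ζ(k) E_k(ω₂/ω₁)` when `Im(ω₂/ω₁) > 0` (homogeneity of the
lattice sums; Silverman AEC C.12, Serre VII §2.2). [folklore] -/
private theorem G_eq_of_im_pos (L : PeriodPair) (h : 0 < (L.ω₂ / L.ω₁).im) {k : ℕ}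
    (hk : 3 ≤ k) :
    L.G k = (L.ω₁ ^ k)⁻¹ * (2 * riemannZeta k * E hk (UpperHalfPlane.mk _ h)) := by
  have hω₁ : L.ω₁ ≠ 0 := by
    rintro h0
    simp [h0] at h
  rw [two_mul_zeta_mul_E_apply, ← tsum_prod_eisSummand, G_eq_tsum_prod, ← tsum_mul_left]
  congr with x
  rw [eisSummand, zpow_neg, zpow_natCast, ← mul_inv, ← mul_pow]
  congr 2
  simp only [Matrix.cons_val_zero, Matrix.cons_val_one]
  field_simp
  ring

/-- `Im(b/a) · |a|² = Re a Im b − Im a Re b`. [folklore] -/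
private theorem im_div_mul_normSq (a b : ℂ) (ha : a ≠ 0) :
    (b / a).im * Complex.normSq a = a.re * b.im - a.im * b.re := by
  rw [Complex.div_im]
  field_simp [(Complex.normSq_pos.mpr ha).ne']

/-- Reduction when `Im(ω₂/ω₁) > 0`: with `τ₀ = ω₂/ω₁` and `γ ∈ SL₂(ℤ)` such that
`Im(γτ₀) ≥ 1/2`, put `τ = γτ₀`, `ω = ω₁ · (cτ₀ + d)`; then `G_k(Λ) = ω^{-k} 2ζ(k)E_k(τ)` and
`covol(Λ) = |ω|² Im τ`. (Silverman 1986, §2: "we choose our `τ_v`'s in the usual fundamental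
domain".) [folklore] -/
private theorem exists_normalForm_of_im_pos (L : PeriodPair) (h : 0 < (L.ω₂ / L.ω₁).im) :
    ∃ (ω : ℂ) (τ : ℍ), ω ≠ 0 ∧ 1 / 2 ≤ τ.im ∧
      L.G 4 = (ω ^ 4)⁻¹ * (2 * riemannZeta (4 : ℕ) * E₄ τ) ∧
      L.G 6 = (ω ^ 6)⁻¹ * (2 * riemannZeta (6 : ℕ) * E₆ τ) ∧
      ZLattice.covolume L.lattice = ‖ω‖ ^ 2 * τ.im := by
  have hω₁ : L.ω₁ ≠ 0 := by
    rintro h0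
    simp [h0] at h
  set τ₀ : ℍ := UpperHalfPlane.mk _ h with hτ₀
  obtain ⟨γ, hγ⟩ := ModularGroup.exists_one_half_le_im_smul τ₀
  have hmem : (γ : GL (Fin 2) ℝ) ∈ 𝒮ℒ := ⟨γ, rfl⟩
  have hd : denom γ τ₀ ≠ 0 := denom_ne_zero γ τ₀
  refine ⟨L.ω₁ * denom γ τ₀, γ • τ₀, mul_ne_zero hω₁ hd, hγ, ?_, ?_, ?_⟩
  · have h4 := SlashInvariantForm.slash_action_eqn'' E₄ hmem τ₀
    rw [ModularGroup.sl_moeb, h4, G_eq_of_im_pos L h (k := 4) (by norm_num)]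
    rw [mul_pow, mul_inv, zpow_ofNat]
    field_simp
    rfl
  · have h6 := SlashInvariantForm.slash_action_eqn'' E₆ hmem τ₀
    rw [ModularGroup.sl_moeb, h6, G_eq_of_im_pos L h (k := 6) (by norm_num)]
    rw [mul_pow, mul_inv, zpow_ofNat]
    field_simp
    rfl
  · rw [ModularGroup.im_smul_eq_div_normSq, covolume_lattice_eq, norm_mul, mul_pow,
      Complex.sq_norm, Complex.sq_norm]
    field_simp
    rw [show τ₀.im = (L.ω₂ / L.ω₁).im from rfl]
    rw [abs_of_pos]
    · have := im_div_mul_normSq L.ω₁ L.ω₂ hω₁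
      linarith
    · have := im_div_mul_normSq L.ω₁ L.ω₂ hω₁
      have hn : 0 < Complex.normSq L.ω₁ := Complex.normSq_pos.mpr hω₁
      nlinarith

/-- **Reduction of an arbitrary period lattice**: `G₄(Λ) = ω⁻⁴ · 2ζ(4) E₄(τ)`,
`G₆(Λ) = ω⁻⁶ · 2ζ(6) E₆(τ)` and `covol(Λ) = |ω|² Im τ` for some `ω ≠ 0` and `τ ∈ ℍ` with
`Im τ ≥ 1/2` (interchange the periods if `Im(ω₂/ω₁) < 0`). (Silverman AEC C.12; Serre VII §2.2.)
[folklore] -/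
private theorem exists_normalForm (L : PeriodPair) :
    ∃ (ω : ℂ) (τ : ℍ), ω ≠ 0 ∧ 1 / 2 ≤ τ.im ∧
      L.G 4 = (ω ^ 4)⁻¹ * (2 * riemannZeta (4 : ℕ) * E₄ τ) ∧
      L.G 6 = (ω ^ 6)⁻¹ * (2 * riemannZeta (6 : ℕ) * E₆ τ) ∧
      ZLattice.covolume L.lattice = ‖ω‖ ^ 2 * τ.im := by
  have hpos := ZLattice.covolume_pos L.lattice MeasureTheory.volume
  rw [covolume_lattice_eq] at hpos
  have hD : L.ω₁.re * L.ω₂.im - L.ω₁.im * L.ω₂.re ≠ 0 := abs_pos.mp hpos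
  rcases lt_or_gt_of_ne hD with hneg | hpos'
  · -- interchange the periods
    have hω₂ : L.ω₂ ≠ 0 := by
      rintro h0
      simp [h0] at hneg
    let L' : PeriodPair :=
      { ω₁ := L.ω₂
        ω₂ := L.ω₁
        indep := by
          rw [LinearIndependent.pair_iff]
          intro s t hst
          have := (LinearIndependent.pair_iff.mp L.indep) t s (by rw [add_comm]; exact hst)
          exact ⟨this.2, this.1⟩ }
    have hlat : L'.lattice = L.lattice := by
      rw [PeriodPair.lattice, PeriodPair.lattice, Set.pair_comm]
    have hG : ∀ n, L'.G n = L.G n := fun n => by rw [PeriodPair.G, PeriodPair.G, hlat]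
    have hc : ZLattice.covolume L'.lattice = ZLattice.covolume L.lattice := by
      rw [covolume_lattice_eq, covolume_lattice_eq, abs_sub_comm]
      congr 1; ring
    have h : 0 < (L'.ω₂ / L'.ω₁).im := by
      have := im_div_mul_normSq L.ω₂ L.ω₁ hω₂
      have hn : 0 < Complex.normSq L.ω₂ := Complex.normSq_pos.mpr hω₂
      have h' : L.ω₂.re * L.ω₁.im - L.ω₂.im * L.ω₁.re =
          -(L.ω₁.re * L.ω₂.im - L.ω₁.im * L.ω₂.re) := by ring
      exact (mul_pos_iff_of_pos_right hn).mp (by rw [this, h']; linarith)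
    obtain ⟨ω, τ, h1, h2, h3, h4, h5⟩ := exists_normalForm_of_im_pos L' h
    exact ⟨ω, τ, h1, h2, (hG 4) ▸ h3, (hG 6) ▸ h4, hc ▸ h5⟩
  · have hω₁ : L.ω₁ ≠ 0 := by
      rintro h0
      simp [h0] at hpos'
    have h : 0 < (L.ω₂ / L.ω₁).im := by
      have := im_div_mul_normSq L.ω₁ L.ω₂ hω₁
      have hn : 0 < Complex.normSq L.ω₁ := Complex.normSq_pos.mpr hω₁
      exact (mul_pos_iff_of_pos_right hn).mp (by rw [this]; exact hpos')
    exact exists_normalForm_of_im_pos L h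

/-! ### The dictionary `c₄ = 16π⁴ω⁻⁴E₄(τ)`, `Δ_V = 2¹²π¹²ω⁻¹²Δ(τ)`, `j_V = E₄³/Δ(τ)` -/

/-- `c₄ = 12 g₂ = 16π⁴ ω⁻⁴ E₄(τ)` for a period lattice in normal form (`g₂ = 60 G₄`,
`ζ(4) = π⁴/90`; Silverman AEC VI.3.6, C.12). [folklore] -/
private theorem c₄_eq_of_normalForm (V : WeierstrassCurve ℂ) {L : PeriodPair}
    (h₂ : L.g₂ = V.c₄ / 12) {ω : ℂ} {τ : ℍ}
    (hG4 : L.G 4 = (ω ^ 4)⁻¹ * (2 * riemannZeta (4 : ℕ) * E₄ τ)) :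
    V.c₄ = 16 * π ^ 4 * (ω ^ 4)⁻¹ * E₄ τ := by
  have h1 := h₂
  rw [PeriodPair.g₂, hG4, Nat.cast_ofNat, riemannZeta_four] at h1
  have : V.c₄ = 12 * (60 * ((ω ^ 4)⁻¹ * (2 * (π ^ 4 / 90) * E₄ τ))) := by
    rw [h1]; ring
  rw [this]; ring

/-- `c₆ = 216 g₃ = 64π⁶ ω⁻⁶ E₆(τ)` for a period lattice in normal form (`g₃ = 140 G₆`,
`ζ(6) = π⁶/945`; Silverman AEC VI.3.6, C.12). [folklore] -/
private theorem c₆_eq_of_normalForm (V : WeierstrassCurve ℂ) {L : PeriodPair}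
    (h₃ : L.g₃ = V.c₆ / 216) {ω : ℂ} {τ : ℍ}
    (hG6 : L.G 6 = (ω ^ 6)⁻¹ * (2 * riemannZeta (6 : ℕ) * E₆ τ)) :
    V.c₆ = 64 * π ^ 6 * (ω ^ 6)⁻¹ * E₆ τ := by
  have h1 := h₃
  rw [PeriodPair.g₃, hG6, Nat.cast_ofNat, PeriodPair.riemannZeta_six] at h1
  have : V.c₆ = 216 * (140 * ((ω ^ 6)⁻¹ * (2 * (π ^ 6 / 945) * E₆ τ))) := by
    rw [h1]; ring
  rw [this]; ring

/-- `Δ_V = (c₄³ − c₆²)/1728 = 2¹²π¹² ω⁻¹² Δ(τ)` (Mathlib `WeierstrassCurve.c_relation` and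
`ModularForm.discriminant_eq_E₄_cube_sub_E₆_sq`; Silverman 1986, §1 "`Δ_v = Δ(τ_v)`").
[folklore] -/
private theorem Δ_eq_of_normalForm (V : WeierstrassCurve ℂ) {L : PeriodPair}
    (h₂ : L.g₂ = V.c₄ / 12) (h₃ : L.g₃ = V.c₆ / 216) {ω : ℂ} {τ : ℍ}
    (hG4 : L.G 4 = (ω ^ 4)⁻¹ * (2 * riemannZeta (4 : ℕ) * E₄ τ))
    (hG6 : L.G 6 = (ω ^ 6)⁻¹ * (2 * riemannZeta (6 : ℕ) * E₆ τ)) :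
    V.Δ = 4096 * π ^ 12 * (ω ^ 12)⁻¹ * ModularForm.discriminant τ := by
  have h := V.c_relation
  rw [c₄_eq_of_normalForm V h₂ hG4, c₆_eq_of_normalForm V h₃ hG6] at h
  rw [ModularForm.discriminant_eq_E₄_cube_sub_E₆_sq]
  have : V.Δ = ((16 * π ^ 4 * (ω ^ 4)⁻¹ * E₄ τ) ^ 3 -
      (64 * π ^ 6 * (ω ^ 6)⁻¹ * E₆ τ) ^ 2) / 1728 := by
    rw [← h]; ring
  rw [this]
  ring

/-- `|j_V| = |E₄(τ)|³/|Δ(τ)|` in normal form (`j = c₄³/Δ`, `(16π⁴)³ = 2¹²π¹²`). [folklore] -/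
private theorem norm_j_eq_of_normalForm (V : WeierstrassCurve ℂ) [V.IsElliptic] {L : PeriodPair}
    (h₂ : L.g₂ = V.c₄ / 12) (h₃ : L.g₃ = V.c₆ / 216) {ω : ℂ} {τ : ℍ} (hω : ω ≠ 0)
    (hG4 : L.G 4 = (ω ^ 4)⁻¹ * (2 * riemannZeta (4 : ℕ) * E₄ τ))
    (hG6 : L.G 6 = (ω ^ 6)⁻¹ * (2 * riemannZeta (6 : ℕ) * E₆ τ)) :
    ‖V.j‖ = ‖E₄ τ‖ ^ 3 / ‖ModularForm.discriminant τ‖ := by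
  have hΔ : V.Δ ≠ 0 := V.isUnit_Δ.ne_zero
  have hd : ModularForm.discriminant τ ≠ 0 := ModularForm.discriminant_ne_zero τ
  have hπ : (π : ℂ) ≠ 0 := Complex.ofReal_ne_zero.mpr Real.pi_ne_zero
  have hj : V.j = V.c₄ ^ 3 / V.Δ := by
    rw [WeierstrassCurve.j, Units.val_inv_eq_inv_val, WeierstrassCurve.coe_Δ', div_eq_inv_mul]
  rw [hj, c₄_eq_of_normalForm V h₂ hG4, Δ_eq_of_normalForm V h₂ h₃ hG4 hG6]
  rw [norm_div, norm_pow]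
  have key : (16 * (π : ℂ) ^ 4 * (ω ^ 4)⁻¹ * E₄ τ) ^ 3 /
      (4096 * π ^ 12 * (ω ^ 12)⁻¹ * ModularForm.discriminant τ) =
      E₄ τ ^ 3 / ModularForm.discriminant τ := by
    field_simp
    ring
  rw [← norm_pow, ← norm_div, key, norm_div, norm_pow]


/-! ### The explicit lower bound -/

/-- **`9 ≤ log max(|j(V)|, 1) + (log|Δ_V| + 6 log((i/2)∫ω∧ω̄))` for every elliptic curve `V/ℂ`**
— Silverman's lower inequality in Prop. 2.1 at one archimedean place, with the explicit constant
`log(4096π¹²) − 6 log 2 − log 2400 ≥ 9` (`|E₄| ≥ 1/4` on `Im τ ≥ 1`, `|Δ(τ)| ≥ 1/2400` on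
`1/2 ≤ Im τ ≤ 1`). [cite: Silverman1986, Prop. 2.1 with §2 eqs. (4)–(7)] -/
theorem nine_le_log_max_j_add_faltingsArchTerm (V : WeierstrassCurve ℂ) [V.IsElliptic] :
    9 ≤ Real.log (max ‖V.j‖ 1) + V.faltingsArchTerm := by
  obtain ⟨L, h₂, h₃⟩ := V.exists_periodPair_of_isElliptic'
  obtain ⟨ω, τ, hω, hτ, hG4, hG6, hcov⟩ := exists_normalForm L
  set y : ℝ := τ.im with hy_def
  set e4 : ℝ := ‖E₄ τ‖ with he4
  set d : ℝ := ‖ModularForm.discriminant τ‖ with hd_def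
  set Φ : ℝ := max d (e4 ^ 3) with hΦ
  set Lj : ℝ := Real.log (max ‖V.j‖ 1) with hLj
  have hy : 1 / 2 ≤ y := hτ
  have hypos : 0 < y := by linarith
  have hd : 0 < d := norm_pos_iff.mpr (ModularForm.discriminant_ne_zero τ)
  have he4nn : 0 ≤ e4 := norm_nonneg _
  have hΦpos : 0 < Φ := lt_max_of_lt_left hd
  have hωpos : 0 < ‖ω‖ := norm_pos_iff.mpr hω
  have hmaxpos : 0 < max ‖V.j‖ 1 := lt_max_of_lt_right one_pos
  -- the dictionary in `ℝ`: `|j| = e4³/d`, `|Δ_V| = P₃ d`, `covol = |ω|² y`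
  have hj : ‖V.j‖ = e4 ^ 3 / d := norm_j_eq_of_normalForm V h₂ h₃ hω hG4 hG6
  set P₃ : ℝ := 4096 * π ^ 12 / ‖ω‖ ^ 12 with hP₃
  have hP₃pos : 0 < P₃ := by positivity
  have hΔn : ‖V.Δ‖ = P₃ * d := by
    rw [Δ_eq_of_normalForm V h₂ h₃ hG4 hG6, hP₃]
    simp [norm_inv, norm_pow, hd_def, div_eq_mul_inv, abs_of_pos Real.pi_pos]
  have hcp : V.complexPeriod / 2 = ‖ω‖ ^ 2 * y := by
    rw [V.complexPeriod_eq_two_mul_covolume' h₂ h₃, hcov]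
    ring
  have hmaxd : max ‖V.j‖ 1 * d = Φ := by
    rw [hj, max_mul_of_nonneg _ _ hd.le, div_mul_cancel₀ _ hd.ne', one_mul, hΦ, max_comm]
  have key : P₃ * (‖ω‖ ^ 2 * y) ^ 6 = 4096 * π ^ 12 * y ^ 6 := by
    rw [hP₃]
    field_simp
  have hX : Lj + V.faltingsArchTerm = Real.log (4096 * π ^ 12) + Real.log Φ + 6 * Real.log y := by
    calc Lj + V.faltingsArchTerm
        = Real.log (max ‖V.j‖ 1) + (Real.log (P₃ * d) + 6 * Real.log (‖ω‖ ^ 2 * y)) := by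
          rw [hLj, WeierstrassCurve.faltingsArchTerm, hΔn, hcp]
      _ = (Real.log (max ‖V.j‖ 1) + Real.log d) +
            (Real.log P₃ + 6 * Real.log (‖ω‖ ^ 2 * y)) := by
          rw [Real.log_mul hP₃pos.ne' hd.ne']; ring
      _ = Real.log Φ + Real.log (4096 * π ^ 12 * y ^ 6) := by
          rw [← Real.log_mul hmaxpos.ne' hd.ne', hmaxd, ← key,
            Real.log_mul hP₃pos.ne' (by positivity), Real.log_pow]
          push_cast
          ring
      _ = Real.log (4096 * π ^ 12) + Real.log Φ + 6 * Real.log y := by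
          rw [Real.log_mul (by positivity) (by positivity), Real.log_pow]
          push_cast
          ring
  rw [hX]
  -- `Φ ≥ 1/2400` and `y ≥ 1/2`
  have hΦ₀Φ : (1 / 2400 : ℝ) ≤ Φ := by
    rcases le_or_gt 1 y with h | h
    · have h1 : 1 / 4 ≤ e4 := one_quarter_le_norm_E₄ τ h
      calc (1 / 2400 : ℝ) ≤ (1 / 4) ^ 3 := by norm_num
        _ ≤ e4 ^ 3 := pow_le_pow_left₀ (by norm_num) h1 3
        _ ≤ Φ := le_max_right _ _
    · calc (1 / 2400 : ℝ) ≤ d := le_norm_discriminant τ hy h.le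
        _ ≤ Φ := le_max_left _ _
  have h1 : Real.log (1 / 2400) ≤ Real.log Φ := Real.log_le_log (by norm_num) hΦ₀Φ
  have h2 : Real.log (1 / 2) ≤ Real.log y := Real.log_le_log (by norm_num) hy
  -- numerics: `log(4096 π¹²) + log(1/2400) + 6 log(1/2) ≥ 9`, i.e. `64 π¹² / 2400 ≥ e⁹`
  have hπ : (3 : ℝ) ≤ π := Real.pi_gt_three.le
  have hπ12 : (3 : ℝ) ^ 12 ≤ π ^ 12 := pow_le_pow_left₀ (by norm_num) hπ 12
  have he9 : Real.exp 9 ≤ 8200 := by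
    have h1 : Real.exp 1 < 2.7182818286 := Real.exp_one_lt_d9
    have : Real.exp 9 = Real.exp 1 ^ 9 := by rw [← Real.exp_nat_mul]; norm_num
    rw [this]
    exact (pow_le_pow_left₀ (Real.exp_pos 1).le h1.le 9).trans (by norm_num)
  have hmain : Real.exp 9 ≤ 4096 * π ^ 12 * (1 / 2400) * (1 / 2) ^ 6 := by
    nlinarith
  have hlog : 9 ≤ Real.log (4096 * π ^ 12 * (1 / 2400) * (1 / 2) ^ 6) := by
    rw [← Real.exp_le_exp, Real.exp_log (by positivity)]; exact hmain
  rw [Real.log_mul (by positivity) (by positivity), Real.log_mul (by positivity) (by positivity),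
    Real.log_pow] at hlog
  push_cast at hlog
  linarith

/-! ### The explicit upper bound -/

/-- **`|E₄(τ)| ≤ 121` for `Im τ ≥ 1/2`**: `E₄ = 1 + 240 ∑ σ₃(n) qⁿ`, `|q| ≤ e^{−π} ≤ 1/20`,
`∑ σ₃(n)|q|ⁿ ≤ ∑ 2(4/20)ⁿ = 1/2`. (Silverman's `O(1)` in §2 eq. (7).)
[cite: Silverman1986, §2 eq. (7)] -/
theorem norm_E₄_le (τ : ℍ) (hτ : 1 / 2 ≤ τ.im) : ‖(E₄ τ : ℂ)‖ ≤ 121 := by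
  have h := EisensteinSeries.q_expansion_bernoulli (by norm_num : 3 ≤ 4) (by decide) τ
  have hb : bernoulli 4 = -1 / 30 := by
    rw [bernoulli_eq_bernoulli'_of_ne_one (by norm_num), bernoulli'_four]
  simp_rw [zpow_natCast] at h
  rw [hb] at h
  set q : ℂ := cexp (2 * π * Complex.I * τ) with hqdef
  set r : ℝ := ‖q‖ with hrdef
  have hr : r = Real.exp (-(2 * π * τ.im)) := by
    rw [hrdef, hqdef, Complex.norm_exp]
    congr 1
    simp [Complex.mul_re, UpperHalfPlane.coe_im, UpperHalfPlane.coe_re]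
  have h' : (E₄ τ : ℂ) = 1 + 240 * ∑' n : ℕ+, (σ 3 n : ℂ) * q ^ (n : ℕ) := by
    rw [show (E₄ τ : ℂ) = E (by norm_num : 3 ≤ 4) τ from rfl, h]
    simp only [show (4 - 1 : ℕ) = 3 from rfl]
    push_cast
    ring
  have hr0 : 0 ≤ r := norm_nonneg _
  have hr20 : r ≤ 1 / 20 := by
    rw [hr]
    refine le_trans (Real.exp_le_exp.mpr ?_) Probability.LatticeModels.exp_neg_pi_le
    nlinarith [Real.pi_pos]
  have h4r : 4 * r < 1 := by linarith
  have h4r0 : 0 ≤ 4 * r := by linarith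
  set g : ℕ → ℂ := fun m ↦ (σ 3 (m + 1) : ℂ) * q ^ (m + 1) with hgdef
  have hS : ∑' n : ℕ+, (σ 3 n : ℂ) * q ^ (n : ℕ) = ∑' m : ℕ, g m :=
    tsum_pnat_eq_tsum_succ (f := fun n : ℕ ↦ (σ 3 n : ℂ) * q ^ n)
  have hbound : ∀ m, ‖g m‖ ≤ 2 * (4 * r) ^ (m + 1) := fun m ↦ by
    rw [hgdef]
    simp only [norm_mul, norm_pow, Complex.norm_natCast, ← hrdef]
    calc (σ 3 (m + 1) : ℝ) * r ^ (m + 1) ≤ 2 * 4 ^ (m + 1) * r ^ (m + 1) := by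
          gcongr; exact sigma_three_le _
      _ = 2 * (4 * r) ^ (m + 1) := by rw [mul_pow]; ring
  have hgeom : Summable (fun m : ℕ ↦ 2 * (4 * r) ^ (m + 1)) := by
    have := (summable_geometric_of_lt_one h4r0 h4r).mul_left (2 * (4 * r))
    refine this.congr (fun m ↦ ?_); ring
  have hval : ∑' m : ℕ, 2 * (4 * r) ^ (m + 1) = 2 * (4 * r) / (1 - 4 * r) := by
    rw [show (fun m : ℕ ↦ 2 * (4 * r) ^ (m + 1)) = fun m ↦ (2 * (4 * r)) * (4 * r) ^ m by
      funext m; ring]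
    rw [tsum_mul_left, tsum_geometric_of_lt_one h4r0 h4r]
    field_simp
  have hT : ‖∑' m, g m‖ ≤ 2 * (4 * r) / (1 - 4 * r) := by
    have h1 : ‖∑' m, g m‖ ≤ ∑' m : ℕ, 2 * (4 * r) ^ (m + 1) :=
      tsum_of_norm_bounded hgeom.hasSum hbound
    rwa [hval] at h1
  have hnum : 2 * (4 * r) / (1 - 4 * r) ≤ 1 / 2 := by
    rw [div_le_iff₀ (by linarith)]; nlinarith
  rw [h', hS]
  calc ‖(1 : ℂ) + 240 * ∑' m, g m‖ ≤ ‖(1 : ℂ)‖ + ‖(240 : ℂ) * ∑' m, g m‖ := norm_add_le _ _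
    _ = 1 + 240 * ‖∑' m, g m‖ := by rw [norm_one, norm_mul, Complex.norm_ofNat]
    _ ≤ 1 + 240 * (1 / 2) := by gcongr; exact hT.trans hnum
    _ = 121 := by norm_num

/-- **`|Δ(τ)| ≤ 4 e^{−2π Im τ}` for `Im τ ≥ 1/2`** (the tree's `norm_discriminant_le_exp_mul_exp`
with `exp(24r/(1 − r)) ≤ exp(24/19) ≤ 4`, `r ≤ 1/20`). [cite: Silverman1986, §2 eq. (4)] -/
theorem norm_discriminant_le (τ : ℍ) (hτ : 1 / 2 ≤ τ.im) :
    ‖ModularForm.discriminant τ‖ ≤ 4 * Real.exp (-(2 * π * τ.im)) := by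
  have h := ModularForms.norm_discriminant_le_exp_mul_exp τ
  set r : ℝ := Real.exp (-(2 * π * τ.im)) with hr
  have hr0 : 0 ≤ r := (Real.exp_pos _).le
  have hr20 : r ≤ 1 / 20 := by
    rw [hr]
    refine le_trans (Real.exp_le_exp.mpr ?_) Probability.LatticeModels.exp_neg_pi_le
    nlinarith [Real.pi_pos]
  have hfrac : 24 * (r / (1 - r)) ≤ 24 / 19 := by
    have : r / (1 - r) ≤ 1 / 19 := by
      rw [div_le_div_iff₀ (by linarith) (by norm_num)]; nlinarith
    linarith
  -- `exp(24/19) ≤ 4`: `e^{1.3} = e · e^{0.3} ≤ 2.72 · (1/0.7)`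
  have he : Real.exp (24 / 19) ≤ 4 := by
    have h1 : Real.exp 1 < 2.7182818286 := Real.exp_one_lt_d9
    have he03 : Real.exp (0.3 : ℝ) ≤ 1 / (1 - 0.3) := by
      have h := Real.add_one_le_exp (-(0.3 : ℝ))
      rw [Real.exp_neg] at h
      rw [le_div_iff₀ (by norm_num)]
      have hpos := Real.exp_pos (0.3 : ℝ)
      have : (1 - 0.3 : ℝ) ≤ (Real.exp 0.3)⁻¹ := by linarith
      calc Real.exp 0.3 * (1 - 0.3) ≤ Real.exp 0.3 * (Real.exp 0.3)⁻¹ := by gcongr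
        _ = 1 := mul_inv_cancel₀ hpos.ne'
    calc Real.exp (24 / 19) ≤ Real.exp (1 + 0.3) := Real.exp_le_exp.mpr (by norm_num)
      _ = Real.exp 1 * Real.exp 0.3 := Real.exp_add _ _
      _ ≤ 2.7182818286 * (1 / (1 - 0.3)) := by gcongr
      _ ≤ 4 := by norm_num
  calc ‖ModularForm.discriminant τ‖ ≤ r * Real.exp (24 * (r / (1 - r))) := h
    _ ≤ r * Real.exp (24 / 19) := by gcongr
    _ ≤ r * 4 := by gcongr
    _ = 4 * r := by ring

/-- **`log max(|j(V)|, 1) + (log|Δ_V| + 6 log((i/2)∫ω∧ω̄)) ≤ 6 log(1 + log max(|j(V)|, 1)) + 37`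
for every elliptic curve `V/ℂ`** — Silverman's upper inequality in Prop. 2.1 at one archimedean
place, with the explicit constant: in normal form (`Im τ ≥ 1/2`) the left side is
`log(4096π¹²) + log max(|Δ(τ)|, |E₄(τ)|³) + 6 log Im τ` with `max ≤ 121³`, and
`Im τ ≤ 1 + log max(|j|, 1)` (for `Im τ ≥ 1`: `|j| = |E₄|³/|Δ| ≥ e^{2π Im τ}/256`).
[cite: Silverman1986, Prop. 2.1 with §2 eqs. (4)–(7)] -/
theorem log_max_j_add_faltingsArchTerm_le (V : WeierstrassCurve ℂ) [V.IsElliptic] :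
    Real.log (max ‖V.j‖ 1) + V.faltingsArchTerm ≤
      6 * Real.log (1 + Real.log (max ‖V.j‖ 1)) + 37 := by
  obtain ⟨L, h₂, h₃⟩ := V.exists_periodPair_of_isElliptic'
  obtain ⟨ω, τ, hω, hτ, hG4, hG6, hcov⟩ := exists_normalForm L
  set y : ℝ := τ.im with hy_def
  set e4 : ℝ := ‖E₄ τ‖ with he4
  set d : ℝ := ‖ModularForm.discriminant τ‖ with hd_def
  set Φ : ℝ := max d (e4 ^ 3) with hΦ
  set Lj : ℝ := Real.log (max ‖V.j‖ 1) with hLj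
  have hy : 1 / 2 ≤ y := hτ
  have hypos : 0 < y := by linarith
  have hd : 0 < d := norm_pos_iff.mpr (ModularForm.discriminant_ne_zero τ)
  have he4nn : 0 ≤ e4 := norm_nonneg _
  have hΦpos : 0 < Φ := lt_max_of_lt_left hd
  have hωpos : 0 < ‖ω‖ := norm_pos_iff.mpr hω
  have hmaxpos : 0 < max ‖V.j‖ 1 := lt_max_of_lt_right one_pos
  have hLj0 : 0 ≤ Lj := Real.log_nonneg (le_max_right _ _)
  have hj : ‖V.j‖ = e4 ^ 3 / d := norm_j_eq_of_normalForm V h₂ h₃ hω hG4 hG6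
  set P₃ : ℝ := 4096 * π ^ 12 / ‖ω‖ ^ 12 with hP₃
  have hP₃pos : 0 < P₃ := by positivity
  have hΔn : ‖V.Δ‖ = P₃ * d := by
    rw [Δ_eq_of_normalForm V h₂ h₃ hG4 hG6, hP₃]
    simp [norm_inv, norm_pow, hd_def, div_eq_mul_inv, abs_of_pos Real.pi_pos]
  have hcp : V.complexPeriod / 2 = ‖ω‖ ^ 2 * y := by
    rw [V.complexPeriod_eq_two_mul_covolume' h₂ h₃, hcov]
    ring
  have hmaxd : max ‖V.j‖ 1 * d = Φ := by
    rw [hj, max_mul_of_nonneg _ _ hd.le, div_mul_cancel₀ _ hd.ne', one_mul, hΦ, max_comm]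
  have key : P₃ * (‖ω‖ ^ 2 * y) ^ 6 = 4096 * π ^ 12 * y ^ 6 := by
    rw [hP₃]
    field_simp
  have hX : Lj + V.faltingsArchTerm = Real.log (4096 * π ^ 12) + Real.log Φ + 6 * Real.log y := by
    calc Lj + V.faltingsArchTerm
        = Real.log (max ‖V.j‖ 1) + (Real.log (P₃ * d) + 6 * Real.log (‖ω‖ ^ 2 * y)) := by
          rw [hLj, WeierstrassCurve.faltingsArchTerm, hΔn, hcp]
      _ = (Real.log (max ‖V.j‖ 1) + Real.log d) +
            (Real.log P₃ + 6 * Real.log (‖ω‖ ^ 2 * y)) := by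
          rw [Real.log_mul hP₃pos.ne' hd.ne']; ring
      _ = Real.log Φ + Real.log (4096 * π ^ 12 * y ^ 6) := by
          rw [← Real.log_mul hmaxpos.ne' hd.ne', hmaxd, ← key,
            Real.log_mul hP₃pos.ne' (by positivity), Real.log_pow]
          push_cast
          ring
      _ = Real.log (4096 * π ^ 12) + Real.log Φ + 6 * Real.log y := by
          rw [Real.log_mul (by positivity) (by positivity), Real.log_pow]
          push_cast
          ring
  rw [hX]
  -- `Φ ≤ 121³`
  have hdle : d ≤ 4 * Real.exp (-(2 * π * y)) := norm_discriminant_le τ hy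
  have hexp1 : Real.exp (-(2 * π * y)) ≤ 1 / 20 := by
    refine le_trans (Real.exp_le_exp.mpr ?_) Probability.LatticeModels.exp_neg_pi_le
    nlinarith [Real.pi_pos]
  have he4le : e4 ≤ 121 := norm_E₄_le τ hy
  have hΦle : Φ ≤ 121 ^ 3 := by
    refine max_le (by linarith) ?_
    exact pow_le_pow_left₀ he4nn he4le 3
  have h1 : Real.log Φ ≤ Real.log ((121 : ℝ) ^ 3) := Real.log_le_log hΦpos hΦle
  -- `y ≤ 1 + Lj`
  have hyle : y ≤ 1 + Lj := by
    rcases le_or_gt y 1 with h | h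
    · linarith
    · -- `|j| ≥ e^{2πy}/256`
      have he4ge : 1 / 4 ≤ e4 := one_quarter_le_norm_E₄ τ h.le
      have hjge : Real.exp (2 * π * y) / 256 ≤ ‖V.j‖ := by
        rw [hj]
        have hexp : 0 < Real.exp (-(2 * π * y)) := Real.exp_pos _
        have h64 : (1 / 4 : ℝ) ^ 3 ≤ e4 ^ 3 := pow_le_pow_left₀ (by norm_num) he4ge 3
        rw [div_le_div_iff₀ (by norm_num) hd]
        have hprod : Real.exp (2 * π * y) * Real.exp (-(2 * π * y)) = 1 := by
          rw [← Real.exp_add]; simp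
        nlinarith [Real.exp_pos (2 * π * y)]
      have hjle : ‖V.j‖ ≤ max ‖V.j‖ 1 := le_max_left _ _
      have hlog : 2 * π * y - Real.log 256 ≤ Lj := by
        have hpos : 0 < Real.exp (2 * π * y) / 256 := by positivity
        have := Real.log_le_log hpos (hjge.trans hjle)
        rwa [Real.log_div (Real.exp_pos _).ne' (by norm_num), Real.log_exp] at this
      have h256 : Real.log 256 ≤ 6 := by
        rw [show (256 : ℝ) = 2 ^ 8 by norm_num, Real.log_pow]
        have := Real.log_two_lt_d9; norm_num at this ⊢; linarith
      have hπ : (3 : ℝ) ≤ π := Real.pi_gt_three.le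
      nlinarith
  have h2 : Real.log y ≤ Real.log (1 + Lj) := Real.log_le_log hypos hyle
  -- numerics: `log(4096 π¹² · 121³) ≤ 37`
  have hπ4 : π ≤ 3.1416 := Real.pi_lt_d4.le
  have hπ12 : π ^ 12 ≤ (3.1416 : ℝ) ^ 12 := pow_le_pow_left₀ Real.pi_pos.le hπ4 12
  have he37 : (4096 * (3.1416 : ℝ) ^ 12) * (121 : ℝ) ^ 3 ≤ Real.exp 37 := by
    have h2 : (2.718 : ℝ) ≤ Real.exp 1 := by
      have := Real.exp_one_gt_d9; linarith
    have : Real.exp 37 = Real.exp 1 ^ 37 := by rw [← Real.exp_nat_mul]; norm_num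
    rw [this]
    exact le_trans (by norm_num) (pow_le_pow_left₀ (by norm_num) h2 37)
  have hlog : Real.log (4096 * π ^ 12) + Real.log ((121 : ℝ) ^ 3) ≤ 37 := by
    rw [← Real.log_mul (by positivity) (by positivity)]
    refine (Real.log_le_iff_le_exp (by positivity)).2 (le_trans ?_ he37)
    gcongr
  linarith

/-- **Silverman's Prop. 2.1 at one archimedean place, with explicit constants
`(C₁, C₂) = (9, 37)`.** [cite: Silverman1986, Prop. 2.1] -/
theorem bounds_log_max_j_add_faltingsArchTerm (V : WeierstrassCurve ℂ) [V.IsElliptic] :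
    9 ≤ Real.log (max ‖V.j‖ 1) + V.faltingsArchTerm ∧
      Real.log (max ‖V.j‖ 1) + V.faltingsArchTerm ≤
        6 * Real.log (1 + Real.log (max ‖V.j‖ 1)) + 37 :=
  ⟨nine_le_log_max_j_add_faltingsArchTerm V, log_max_j_add_faltingsArchTerm_le V⟩

end FaltingsHeightExplicit

open FaltingsHeightExplicit

/-! ### The stable Faltings height, explicitly -/

open _root_.NumberField in
/-- **`h_F(E) ≤ (1/12)([K:ℚ]⁻¹ log N(𝔇_j) + [K:ℚ]⁻¹ Σ_{σ : K → ℂ} log max(|σ j|, 1) − 9)`** for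
every elliptic curve over a number field: the closed formula for `h_F` (`stableFaltingsHeight`) and
the explicit archimedean lower bound `nine_le_log_max_j_add_faltingsArchTerm` at each embedding.
(The bracket is the absolute logarithmic Weil height of `j(E)`; Silverman's Prop. 2.1, lower
inequality, stable form, explicit.)
[cite: Silverman1986, Prop. 2.1] -/
theorem stableFaltingsHeight_le_explicit {K : Type*} [Field K] [NumberField K]
    (W : WeierstrassCurve K) [W.IsElliptic] :
    W.stableFaltingsHeight ≤ (1 / 12) *
      ((Module.finrank ℚ K : ℝ)⁻¹ * Real.log (Ideal.absNorm W.jDenominatorIdeal) +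
        (Module.finrank ℚ K : ℝ)⁻¹ * ∑ σ : K →+* ℂ, Real.log (max ‖σ W.j‖ 1) - 9) := by
  have hd : (0 : ℝ) < Module.finrank ℚ K := by exact_mod_cast Module.finrank_pos
  have hσ : ∀ σ : K →+* ℂ, 9 - Real.log (max ‖σ W.j‖ 1) ≤ (W.map σ).faltingsArchTerm := fun σ ↦ by
    haveI : (W.map σ).IsElliptic := by infer_instance
    have h := nine_le_log_max_j_add_faltingsArchTerm (W.map σ)
    rw [WeierstrassCurve.map_j] at h
    linarith
  have hsum : ∑ σ : K →+* ℂ, (9 - Real.log (max ‖σ W.j‖ 1)) ≤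
      ∑ σ : K →+* ℂ, (W.map σ).faltingsArchTerm := Finset.sum_le_sum fun σ _ ↦ hσ σ
  rw [Finset.sum_sub_distrib, Finset.sum_const, Finset.card_univ,
    NumberField.Embeddings.card K ℂ, nsmul_eq_mul] at hsum
  rw [WeierstrassCurve.stableFaltingsHeight]
  have hinv : (12 * (Module.finrank ℚ K : ℝ))⁻¹ = (1 / 12) * (Module.finrank ℚ K : ℝ)⁻¹ := by
    rw [mul_inv, one_div]
  rw [hinv, mul_assoc]
  refine mul_le_mul_of_nonneg_left ?_ (by norm_num)
  have h := mul_le_mul_of_nonneg_left hsum (inv_nonneg.2 hd.le)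
  rw [mul_sub, ← mul_assoc, inv_mul_cancel₀ hd.ne', one_mul] at h
  linarith

open _root_.NumberField in
/-- **`h_F(E) ≤ 1` for every elliptic curve with `j(E) = 207646/6561`** over a number field (the
non-CM class of curves of Belyi degree `4`, `BelyiDegreeFourConverse`): `6561 ∈ 𝔇_j`, so
`N(𝔇_j) ≤ 6561^{[K:ℚ]}`; every `|σ j| = 207646/6561`; and `log 207646 − 9 ≤ 12`.
[cite: Silverman1986, Prop. 2.1] -/
theorem stableFaltingsHeight_le_one_of_j_eq {K : Type*} [Field K] [NumberField K]
    (W : WeierstrassCurve K) [W.IsElliptic] (hj : W.j = 207646 / 6561) :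
    W.stableFaltingsHeight ≤ 1 := by
  have h := stableFaltingsHeight_le_explicit W
  have hd : (0 : ℝ) < Module.finrank ℚ K := by exact_mod_cast Module.finrank_pos
  -- the denominator ideal contains `6561`
  have hmem : ((6561 : ℤ) : 𝓞 K) ∈ W.jDenominatorIdeal := by
    rw [WeierstrassCurve.mem_jDenominatorIdeal]
    refine ⟨(207646 : ℤ), ?_⟩
    have e1 : (((6561 : ℤ) : 𝓞 K) : K) = 6561 := by
      rw [RingOfIntegers.coe_eq_algebraMap, map_intCast]; norm_num
    have e2 : (((207646 : ℤ) : 𝓞 K) : K) = 207646 := by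
      rw [RingOfIntegers.coe_eq_algebraMap, map_intCast]; norm_num
    rw [e1, e2, hj]; norm_num
  have hle : Ideal.span {((6561 : ℤ) : 𝓞 K)} ≤ W.jDenominatorIdeal :=
    (Ideal.span_singleton_le_iff_mem _).2 hmem
  have hdvd := Ideal.absNorm_dvd_absNorm_of_le hle
  have hspan : Ideal.absNorm (Ideal.span {((6561 : ℤ) : 𝓞 K)}) = 6561 ^ Module.finrank ℚ K := by
    rw [Ideal.absNorm_span_singleton, show ((6561 : ℤ) : 𝓞 K) = algebraMap ℤ (𝓞 K) 6561 by simp,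
      Algebra.norm_algebraMap, RingOfIntegers.rank]
    simp [Int.natAbs_pow]
  have hN0 : Ideal.absNorm W.jDenominatorIdeal ≠ 0 := by
    rw [Ne, Ideal.absNorm_eq_zero_iff]; exact W.jDenominatorIdeal_ne_bot
  have hNle : (Ideal.absNorm W.jDenominatorIdeal : ℝ) ≤ (6561 : ℝ) ^ Module.finrank ℚ K := by
    have := Nat.le_of_dvd (by rw [hspan]; positivity) hdvd
    rw [hspan] at this
    exact_mod_cast this
  have hlogN : Real.log (Ideal.absNorm W.jDenominatorIdeal) ≤
      Module.finrank ℚ K * Real.log 6561 := by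
    rw [← Real.log_pow]
    exact Real.log_le_log (by exact_mod_cast Nat.pos_of_ne_zero hN0) hNle
  -- the archimedean sizes of `j`
  have hσ : ∀ σ : K →+* ℂ, Real.log (max ‖σ W.j‖ 1) = Real.log (207646 / 6561) := fun σ ↦ by
    rw [hj, map_div₀, map_ofNat, map_ofNat]
    rw [show ((207646 : ℂ) / 6561) = ((207646 / 6561 : ℝ) : ℂ) by push_cast; ring,
      Complex.norm_real, Real.norm_of_nonneg (by norm_num),
      max_eq_left (by norm_num)]
  rw [Finset.sum_congr rfl fun σ _ ↦ hσ σ, Finset.sum_const, Finset.card_univ,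
    NumberField.Embeddings.card K ℂ, nsmul_eq_mul] at h
  -- numerics
  have hsum : (Module.finrank ℚ K : ℝ)⁻¹ * Real.log (Ideal.absNorm W.jDenominatorIdeal) +
      (Module.finrank ℚ K : ℝ)⁻¹ * (Module.finrank ℚ K * Real.log (207646 / 6561)) ≤
      Real.log 6561 + Real.log (207646 / 6561) := by
    have h1 : (Module.finrank ℚ K : ℝ)⁻¹ * Real.log (Ideal.absNorm W.jDenominatorIdeal) ≤
        Real.log 6561 := by
      rw [inv_mul_le_iff₀ hd]; exact hlogN
    have h2 : (Module.finrank ℚ K : ℝ)⁻¹ * (Module.finrank ℚ K * Real.log (207646 / 6561)) =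
        Real.log (207646 / 6561) := by
      field_simp
    linarith
  have hlog : Real.log 6561 + Real.log (207646 / 6561) ≤ 21 := by
    rw [← Real.log_mul (by norm_num) (by norm_num), show (6561 * (207646 / 6561) : ℝ) = 207646 by
      norm_num]
    have h2 : (2 : ℝ) ≤ Real.exp 1 := by
      have := Real.add_one_le_exp (1 : ℝ); norm_num at this ⊢; linarith
    have h21 : (207646 : ℝ) ≤ Real.exp 21 := by
      have : Real.exp 21 = Real.exp 1 ^ 21 := by rw [← Real.exp_nat_mul]; norm_num
      rw [this]
      exact le_trans (by norm_num) (pow_le_pow_left₀ (by norm_num) h2 21)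
    exact (Real.log_le_iff_le_exp (by norm_num)).2 h21
  linarith

open _root_.NumberField in
/-- **`h_F(E) ≤ (1/12)(log max(|a|, b) − 9)` for every elliptic curve with rational
`j(E) = a/b`** (lowest terms) over any number field: `b ∈ 𝔇_j`, so `N(𝔇_j) ≤ b^{[K:ℚ]}`, every
`|σ j| = |a/b|`, and `log b + log max(|a/b|, 1) = log max(|a|, b)` — the explicit lower
inequality of Silverman's Prop. 2.1 for rational `j` (`h(j) = log max(|a|, b)`).
[cite: Silverman1986, Prop. 2.1] -/
theorem stableFaltingsHeight_le_of_j_eq_ratCast {K : Type*} [Field K] [NumberField K]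
    (W : WeierstrassCurve K) [W.IsElliptic] (q : ℚ) (hj : W.j = (q : K)) :
    W.stableFaltingsHeight ≤ (1 / 12) * (Real.log (max |(q.num : ℝ)| (q.den : ℝ)) - 9) := by
  have h := stableFaltingsHeight_le_explicit W
  have hd : (0 : ℝ) < Module.finrank ℚ K := by exact_mod_cast Module.finrank_pos
  have hden0 : (0 : ℝ) < q.den := by exact_mod_cast q.den_pos
  -- the denominator ideal contains `q.den`
  have hmem : ((q.den : ℤ) : 𝓞 K) ∈ W.jDenominatorIdeal := by
    rw [WeierstrassCurve.mem_jDenominatorIdeal]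
    refine ⟨(q.num : ℤ), ?_⟩
    have e1 : (((q.den : ℤ) : 𝓞 K) : K) = ((q.den : ℚ) : K) := by
      rw [RingOfIntegers.coe_eq_algebraMap, map_intCast]; push_cast; rfl
    have e2 : (((q.num : ℤ) : 𝓞 K) : K) = ((q.num : ℚ) : K) := by
      rw [RingOfIntegers.coe_eq_algebraMap, map_intCast]; push_cast; rfl
    rw [e1, e2, hj, ← Rat.cast_mul, mul_comm, Rat.mul_den_eq_num]
  have hle : Ideal.span {((q.den : ℤ) : 𝓞 K)} ≤ W.jDenominatorIdeal :=
    (Ideal.span_singleton_le_iff_mem _).2 hmem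
  have hdvd := Ideal.absNorm_dvd_absNorm_of_le hle
  have hspan : Ideal.absNorm (Ideal.span {((q.den : ℤ) : 𝓞 K)}) = q.den ^ Module.finrank ℚ K := by
    rw [Ideal.absNorm_span_singleton,
      show ((q.den : ℤ) : 𝓞 K) = algebraMap ℤ (𝓞 K) q.den by simp,
      Algebra.norm_algebraMap, RingOfIntegers.rank]
    simp [Int.natAbs_pow]
  have hN0 : Ideal.absNorm W.jDenominatorIdeal ≠ 0 := by
    rw [Ne, Ideal.absNorm_eq_zero_iff]; exact W.jDenominatorIdeal_ne_bot
  have hNle : (Ideal.absNorm W.jDenominatorIdeal : ℝ) ≤ (q.den : ℝ) ^ Module.finrank ℚ K := by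
    have := Nat.le_of_dvd (by rw [hspan]; exact pow_pos q.den_pos _) hdvd
    rw [hspan] at this
    exact_mod_cast this
  have hlogN : Real.log (Ideal.absNorm W.jDenominatorIdeal) ≤
      Module.finrank ℚ K * Real.log q.den := by
    rw [← Real.log_pow]
    exact Real.log_le_log (by exact_mod_cast Nat.pos_of_ne_zero hN0) hNle
  -- the archimedean sizes of `j`
  have hσ : ∀ σ : K →+* ℂ, Real.log (max ‖σ W.j‖ 1) = Real.log (max |(q : ℝ)| 1) := fun σ ↦ by
    rw [hj, map_ratCast, show ((q : ℂ)) = ((q : ℝ) : ℂ) by push_cast; rfl, Complex.norm_real,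
      Real.norm_eq_abs]
  rw [Finset.sum_congr rfl fun σ _ ↦ hσ σ, Finset.sum_const, Finset.card_univ,
    NumberField.Embeddings.card K ℂ, nsmul_eq_mul] at h
  have h1 : (Module.finrank ℚ K : ℝ)⁻¹ * Real.log (Ideal.absNorm W.jDenominatorIdeal) ≤
      Real.log q.den := by
    rw [inv_mul_le_iff₀ hd]; exact hlogN
  have h2 : (Module.finrank ℚ K : ℝ)⁻¹ * (Module.finrank ℚ K * Real.log (max |(q : ℝ)| 1)) =
      Real.log (max |(q : ℝ)| 1) := by
    field_simp
  -- `log b + log max(|a/b|, 1) = log max(|a|, b)`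
  have hkey : Real.log q.den + Real.log (max |(q : ℝ)| 1) =
      Real.log (max |(q.num : ℝ)| (q.den : ℝ)) := by
    rw [← Real.log_mul hden0.ne' (lt_max_of_lt_right one_pos).ne']
    congr 1
    have hq : (q : ℝ) * q.den = q.num := by exact_mod_cast Rat.mul_den_eq_num q
    rw [mul_max_of_nonneg _ _ hden0.le, mul_one, ← abs_of_pos hden0, ← abs_mul, mul_comm, hq,
      abs_of_pos hden0]
  nlinarith [h1, h2, hkey]

open _root_.NumberField _root_.Height in
/-- **Silverman's lower inequality, stable and explicit, in terms of the Weil height of `j`**: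
`h_F(E) ≤ (1/12)([K:ℚ]⁻¹ log H_K(j_E) − 9)` with Mathlib's relative logarithmic height
`logHeight₁` (`[K:ℚ]⁻¹ log H_K = h`, the absolute height; `logHeight₁_j_eq_sum_embeddings`).
[cite: Silverman1986, Prop. 2.1] -/
theorem stableFaltingsHeight_le_logHeight₁ {K : Type*} [Field K] [NumberField K]
    (W : WeierstrassCurve K) [W.IsElliptic] :
    W.stableFaltingsHeight ≤
      (1 / 12) * ((Module.finrank ℚ K : ℝ)⁻¹ * logHeight₁ W.j - 9) := by
  have h := stableFaltingsHeight_le_explicit W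
  rw [logHeight₁_j_eq_sum_embeddings, mul_add]
  exact h

open _root_.NumberField _root_.Height in
/-- **Silverman 1986, Proposition 2.1 with explicit constants**: for every number field `K` and
every elliptic curve `E/K` with Weierstrass model `W`,
`9 ≤ h(j_E) + [K:ℚ]⁻¹ log N Υ_{E/K} − 12 h(E/K) ≤ 6 log(1 + h(j_E)) + 37`
(the statement of the tree's named fact `silverman1986_jHeight_faltingsHeight` with
`(C₁, C₂) = (9, 37)`; same proof as `silverman1986_jHeight_faltingsHeight_holds`, fed with
`bounds_log_max_j_add_faltingsArchTerm`). [cite: Silverman1986, Prop. 2.1 (p. 257)] -/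
theorem silverman1986_jHeight_faltingsHeight_explicit (K : Type) [Field K] [NumberField K]
    (W : WeierstrassCurve K) [W.IsElliptic] :
    9 ≤ (Module.finrank ℚ K : ℝ)⁻¹ * logHeight₁ W.j +
        (Module.finrank ℚ K : ℝ)⁻¹ * (Real.log (W.minimalDiscriminantNorm (𝓞 K)) -
          Real.log (Ideal.absNorm W.jDenominatorIdeal)) - 12 * W.faltingsHeight ∧
    (Module.finrank ℚ K : ℝ)⁻¹ * logHeight₁ W.j +
        (Module.finrank ℚ K : ℝ)⁻¹ * (Real.log (W.minimalDiscriminantNorm (𝓞 K)) -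
          Real.log (Ideal.absNorm W.jDenominatorIdeal)) - 12 * W.faltingsHeight ≤
      6 * Real.log (1 + (Module.finrank ℚ K : ℝ)⁻¹ * logHeight₁ W.j) + 37 := by
  -- `n = [K:ℚ] = #(K → ℂ)`
  set n : ℝ := (Module.finrank ℚ K : ℝ) with hn_def
  have hnpos : 0 < n := by
    rw [hn_def]
    exact_mod_cast Module.finrank_pos (R := ℚ) (M := K)
  have hn : n ≠ 0 := hnpos.ne'
  have hcard : ((Finset.univ : Finset (K →+* ℂ)).card : ℝ) = n := by
    rw [Finset.card_univ, NumberField.Embeddings.card K ℂ]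
  set Lσ : (K →+* ℂ) → ℝ := fun σ => Real.log (max ‖σ W.j‖ 1) with hLσ
  set Fσ : (K →+* ℂ) → ℝ := fun σ => Lσ σ + (W.map σ).faltingsArchTerm with hFσ
  have hL0 : ∀ σ, 0 ≤ Lσ σ := fun σ => Real.log_nonneg (le_max_right _ _)
  have hQ : n⁻¹ * logHeight₁ W.j +
      n⁻¹ * (Real.log (W.minimalDiscriminantNorm (𝓞 K)) -
        Real.log (Ideal.absNorm W.jDenominatorIdeal)) - 12 * W.faltingsHeight =
      n⁻¹ * ∑ σ : K →+* ℂ, Fσ σ := by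
    simp only [hFσ, hLσ]
    rw [logHeight₁_j_eq_sum_embeddings, WeierstrassCurve.faltingsHeight, Finset.sum_add_distrib]
    rw [← hn_def]
    field_simp
    ring
  have hσ : ∀ σ : K →+* ℂ, 9 ≤ Fσ σ ∧ Fσ σ ≤ 6 * Real.log (1 + Lσ σ) + 37 := by
    intro σ
    haveI : (W.map σ).IsElliptic := by infer_instance
    have h := bounds_log_max_j_add_faltingsArchTerm (W.map σ)
    rw [WeierstrassCurve.map_j] at h
    exact h
  have hsumL : ∑ σ : K →+* ℂ, Lσ σ ≤ logHeight₁ W.j := by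
    rw [logHeight₁_j_eq_sum_embeddings]
    have hD : 0 ≤ Real.log (Ideal.absNorm W.jDenominatorIdeal) := by
      refine Real.log_nonneg ?_
      have h1 : Ideal.absNorm W.jDenominatorIdeal ≠ 0 := by
        rw [Ne, Ideal.absNorm_eq_zero_iff]
        exact W.jDenominatorIdeal_ne_bot
      exact_mod_cast Nat.one_le_iff_ne_zero.mpr h1
    linarith
  rw [hQ]
  constructor
  · have hlow : ∑ σ : K →+* ℂ, (9 : ℝ) ≤ ∑ σ : K →+* ℂ, Fσ σ :=
      Finset.sum_le_sum fun σ _ => (hσ σ).1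
    rw [Finset.sum_const, nsmul_eq_mul, hcard] at hlow
    calc (9 : ℝ) = n⁻¹ * (n * 9) := by field_simp
      _ ≤ n⁻¹ * ∑ σ : K →+* ℂ, Fσ σ := by gcongr
  · have hup : ∑ σ : K →+* ℂ, Fσ σ ≤ 6 * ∑ σ : K →+* ℂ, Real.log (1 + Lσ σ) + n * 37 := by
      calc ∑ σ : K →+* ℂ, Fσ σ ≤ ∑ σ : K →+* ℂ, (6 * Real.log (1 + Lσ σ) + 37) :=
            Finset.sum_le_sum fun σ _ => (hσ σ).2
        _ = 6 * ∑ σ : K →+* ℂ, Real.log (1 + Lσ σ) + n * 37 := by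
            rw [Finset.sum_add_distrib, Finset.sum_const, nsmul_eq_mul, hcard, ← Finset.mul_sum]
    have hJ : ∑ σ : K →+* ℂ, n⁻¹ • Real.log (1 + Lσ σ) ≤
        Real.log (∑ σ : K →+* ℂ, n⁻¹ • (1 + Lσ σ)) :=
      (strictConcaveOn_log_Ioi.concaveOn).le_map_sum (t := Finset.univ)
        (fun σ _ => inv_nonneg.mpr hnpos.le)
        (by rw [Finset.sum_const, nsmul_eq_mul, hcard]; field_simp)
        (fun σ _ => Set.mem_Ioi.mpr (by linarith [hL0 σ]))
    simp only [smul_eq_mul] at hJ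
    rw [← Finset.mul_sum, ← Finset.mul_sum, Finset.sum_add_distrib, Finset.sum_const,
      nsmul_eq_mul, hcard, mul_add, mul_one, inv_mul_cancel₀ hn] at hJ
    have hmono : Real.log (1 + n⁻¹ * ∑ σ : K →+* ℂ, Lσ σ) ≤
        Real.log (1 + n⁻¹ * logHeight₁ W.j) := by
      refine Real.log_le_log ?_ ?_
      · have : 0 ≤ n⁻¹ * ∑ σ : K →+* ℂ, Lσ σ :=
          mul_nonneg (inv_nonneg.mpr hnpos.le) (Finset.sum_nonneg fun σ _ => hL0 σ)
        linarith
      · gcongr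
    calc n⁻¹ * ∑ σ : K →+* ℂ, Fσ σ
        ≤ n⁻¹ * (6 * ∑ σ : K →+* ℂ, Real.log (1 + Lσ σ) + n * 37) := by gcongr
      _ = 6 * (n⁻¹ * ∑ σ : K →+* ℂ, Real.log (1 + Lσ σ)) + 37 := by field_simp
      _ ≤ 6 * Real.log (1 + n⁻¹ * ∑ σ : K →+* ℂ, Lσ σ) + 37 := by gcongr
      _ ≤ 6 * Real.log (1 + n⁻¹ * logHeight₁ W.j) + 37 := by gcongr

open _root_.NumberField _root_.Height in
/-- **The stable form with explicit constants: `h(j_E) ≤ 12 h_F(E) + 6 log(1 + h(j_E)) + 37`**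
(`h(j) = [K:ℚ]⁻¹ log H_K(j)`; from the unstable form, `log N𝔇 ≤ log N Δ_min` being the tree's
`silverman1986_jHeight_faltingsHeight.stableFaltingsHeight_form` route — here directly: the
per-embedding upper bounds and `12 [K:ℚ] h_F = log N𝔇 − Σ_σ archTerm_σ`, `log N𝔇 ≥ 0`).
[cite: Silverman1986, Prop. 2.1 ("in particular")] -/
theorem jHeight_le_stableFaltingsHeight_explicit (K : Type) [Field K] [NumberField K]
    (W : WeierstrassCurve K) [W.IsElliptic] :
    (Module.finrank ℚ K : ℝ)⁻¹ * logHeight₁ W.j ≤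
      12 * W.stableFaltingsHeight + 6 * Real.log (1 + (Module.finrank ℚ K : ℝ)⁻¹ * logHeight₁ W.j)
        + 37 := by
  set n : ℝ := (Module.finrank ℚ K : ℝ) with hn_def
  have hnpos : 0 < n := by
    rw [hn_def]
    exact_mod_cast Module.finrank_pos (R := ℚ) (M := K)
  have hn : n ≠ 0 := hnpos.ne'
  have hcard : ((Finset.univ : Finset (K →+* ℂ)).card : ℝ) = n := by
    rw [Finset.card_univ, NumberField.Embeddings.card K ℂ]
  set Lσ : (K →+* ℂ) → ℝ := fun σ => Real.log (max ‖σ W.j‖ 1) with hLσ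
  have hL0 : ∀ σ, 0 ≤ Lσ σ := fun σ => Real.log_nonneg (le_max_right _ _)
  have hD : 0 ≤ Real.log (Ideal.absNorm W.jDenominatorIdeal) := by
    refine Real.log_nonneg ?_
    have h1 : Ideal.absNorm W.jDenominatorIdeal ≠ 0 := by
      rw [Ne, Ideal.absNorm_eq_zero_iff]
      exact W.jDenominatorIdeal_ne_bot
    exact_mod_cast Nat.one_le_iff_ne_zero.mpr h1
  -- per embedding: `L_σ ≤ 6 log(1 + L_σ) + 37 − archTerm_σ`
  have hσ : ∀ σ : K →+* ℂ, Lσ σ + (W.map σ).faltingsArchTerm ≤ 6 * Real.log (1 + Lσ σ) + 37 := by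
    intro σ
    haveI : (W.map σ).IsElliptic := by infer_instance
    have h := log_max_j_add_faltingsArchTerm_le (W.map σ)
    rw [WeierstrassCurve.map_j] at h
    exact h
  have hsum : ∑ σ : K →+* ℂ, (Lσ σ + (W.map σ).faltingsArchTerm) ≤
      6 * ∑ σ : K →+* ℂ, Real.log (1 + Lσ σ) + n * 37 := by
    calc ∑ σ : K →+* ℂ, (Lσ σ + (W.map σ).faltingsArchTerm)
        ≤ ∑ σ : K →+* ℂ, (6 * Real.log (1 + Lσ σ) + 37) := Finset.sum_le_sum fun σ _ => hσ σ
      _ = 6 * ∑ σ : K →+* ℂ, Real.log (1 + Lσ σ) + n * 37 := by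
          rw [Finset.sum_add_distrib, Finset.sum_const, nsmul_eq_mul, hcard, ← Finset.mul_sum]
  rw [Finset.sum_add_distrib] at hsum
  -- Jensen
  have hJ : ∑ σ : K →+* ℂ, n⁻¹ • Real.log (1 + Lσ σ) ≤
      Real.log (∑ σ : K →+* ℂ, n⁻¹ • (1 + Lσ σ)) :=
    (strictConcaveOn_log_Ioi.concaveOn).le_map_sum (t := Finset.univ)
      (fun σ _ => inv_nonneg.mpr hnpos.le)
      (by rw [Finset.sum_const, nsmul_eq_mul, hcard]; field_simp)
      (fun σ _ => Set.mem_Ioi.mpr (by linarith [hL0 σ]))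
  simp only [smul_eq_mul] at hJ
  rw [← Finset.mul_sum, ← Finset.mul_sum, Finset.sum_add_distrib, Finset.sum_const,
    nsmul_eq_mul, hcard, mul_add, mul_one, inv_mul_cancel₀ hn] at hJ
  have hsumL : n⁻¹ * ∑ σ : K →+* ℂ, Lσ σ ≤ n⁻¹ * logHeight₁ W.j := by
    rw [logHeight₁_j_eq_sum_embeddings]; gcongr; linarith
  have hmono : Real.log (1 + n⁻¹ * ∑ σ : K →+* ℂ, Lσ σ) ≤
      Real.log (1 + n⁻¹ * logHeight₁ W.j) := by
    refine Real.log_le_log ?_ (by linarith)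
    have : 0 ≤ n⁻¹ * ∑ σ : K →+* ℂ, Lσ σ :=
      mul_nonneg (inv_nonneg.mpr hnpos.le) (Finset.sum_nonneg fun σ _ => hL0 σ)
    linarith
  -- `12 n h_F = log N𝔇 − Σ archTerm`
  have hF : 12 * W.stableFaltingsHeight =
      n⁻¹ * (Real.log (Ideal.absNorm W.jDenominatorIdeal) -
        ∑ σ : K →+* ℂ, (W.map σ).faltingsArchTerm) := by
    rw [WeierstrassCurve.stableFaltingsHeight, ← hn_def]
    field_simp
  -- assemble: `h(j) = n⁻¹ log N𝔇 + n⁻¹ Σ L_σ`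
  have hh : n⁻¹ * logHeight₁ W.j = n⁻¹ * Real.log (Ideal.absNorm W.jDenominatorIdeal) +
      n⁻¹ * ∑ σ : K →+* ℂ, Lσ σ := by
    rw [logHeight₁_j_eq_sum_embeddings, mul_add]
  have hmain : n⁻¹ * ∑ σ : K →+* ℂ, Lσ σ + n⁻¹ * ∑ σ : K →+* ℂ, (W.map σ).faltingsArchTerm ≤
      6 * (n⁻¹ * ∑ σ : K →+* ℂ, Real.log (1 + Lσ σ)) + 37 := by
    have := mul_le_mul_of_nonneg_left hsum (inv_nonneg.mpr hnpos.le)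
    rw [mul_add, mul_add, ← mul_assoc n⁻¹ 6, mul_comm n⁻¹ 6, mul_assoc, ← mul_assoc n⁻¹ n,
      inv_mul_cancel₀ hn, one_mul] at this
    exact this
  have hF' : 12 * W.stableFaltingsHeight = n⁻¹ * Real.log (Ideal.absNorm W.jDenominatorIdeal) -
      n⁻¹ * ∑ σ : K →+* ℂ, (W.map σ).faltingsArchTerm := by rw [hF, mul_sub]
  have ha : 0 ≤ n⁻¹ * Real.log (Ideal.absNorm W.jDenominatorIdeal) :=
    mul_nonneg (inv_nonneg.mpr hnpos.le) hD
  linarith [hmain, hJ, hmono, hh, hF']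

end Literature.NumberTheory.DiophantineGeometry

end
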